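import Summits.HubbardSuperconductivity.HubbardSuperconductivity.Theorems.KLProgrammeKLRegimeScaleZeroCovarianceTorusPeriodisation
import Literature.MathematicalPhysics.QuantumLattice.HubbardUVSymbolBandComposition
import Summits.HubbardSuperconductivity.HubbardSuperconductivity.Theorems.KLProgrammeKLRegimeEngineScaleZeroE4Bands

/-!
# Route `KLProgramme`, crux K3 — engine-flow child (stmt-HubbardSuperconductivity-20437), stub (C) at `n = 0`, located item #22a «(C)-SCALE0-PT2»,
# L-layer §2a (L): the MOMENTUM-JET NUMBER `D(ω)` of the spatial symbol — the one hypothesis of `…ScaleZeroCovarianceTorusPeriodisation`,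
# discharged from the tree's joint symbol jets and the band jets; the bare frame `K = 0` fully explicit

Cell gate-hubbard-kl, seat p1 g19.  With `g_ω(y) = Ψ(ω, e_K(2πy))` = `uvSymbol₂ c Λ (fbPt ω (frameLevel μ K (2π•y)))` (`HubbardUVSymbolJoint.uvSymbol₂_apply_eq_uvSymbolFn`):

* §1 `norm_iteratedFDeriv_comp_smul_le` — rescaling `y ↦ f(a•y)` costs `|a|ⁿ` (Mathlib `ContinuousLinearMap.iteratedFDeriv_comp_right`);
* §2 `uvSpatialSymbol_eq_uvSymbol₂_comp` — the spatial symbol as the joint symbol composed with the band;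
* §3 **`norm_iteratedFDeriv_uvSpatialSymbol_le`** — from the cutoff table `|χ₂^{(i)}| ≤ B` (`i ≤ n`, `B ≥ 1`) and band jets `‖Dⁱ e_K‖ ≤ D_Kⁱ` (`1 ≤ i ≤ n`):
  `‖Dⁿ g_ω(y)‖ ≤ n!·(c·B·(n+1)!·(2/m(ω))·max(1, 2/m(ω))ⁿ)·(2π·D_K)ⁿ`, `m(ω) = max(|ω|, Λ/2)`
  (`HubbardUVSymbolJoint.norm_iteratedFDeriv_uvSymbol₂_le` + `HubbardUVSymbolBandComposition.norm_iteratedFDeriv_uvSymbol₂_comp_band_le`);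
* §4 `norm_iteratedFDeriv_frameLevel_zero_le_pow` twin at the BARE frame: `D_K = 4` (`…EngineScaleZeroE4Bands.norm_iteratedFDeriv_frameLevel_zero_le`);
  **`norm_iteratedFDeriv_uvSpatialSymbol_bare_le`**;
* §5 the torus-comparison clause and the off-site L-uniform decay of `…ScaleZeroCovarianceTorusPeriodisation` at the bare frame with these numbers:
  **`norm_torusFourierInv_uvSpatialSample_sub_kernel_le_bare`**, **`norm_torusFourierInv_uvSpatialSample_le_inv_pow_offSite_bare`**;
* §6 (appended by p1 g20, 2026-08-28) ORDERS `n ≥ 1` NEVER READ THE VALUE OF THE SYMBOL: `norm_iteratedFDeriv_comp_le_of_one_le` (Mathlib's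
  `norm_iteratedFDeriv_comp_le` applied to `g − g(f x)`: the order-`0` jet of the outer function is not needed for `n ≥ 1`),
  `norm_iteratedFDeriv_uvSymbol₂_comp_band_le_of_one_le`, **`norm_iteratedFDeriv_uvSpatialSymbol_le_of_one_le`** —
  `‖Dⁿ g_ω(y)‖ ≤ n!·(c·B·(n+1)!·(2/m(ω))²·max(1, 2/m(ω))^{n−1})·(2π·D_K)ⁿ` for `n ≥ 1`, one power of `1/m(ω)` better (the true `O(1/ω²)` size of every
  momentum derivative of the UV symbol), its bare twin `…_bare_le_of_one_le`, and the §5 clauses with this constant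
  **`norm_torusFourierInv_uvSpatialSample_sub_kernel_le_bare_sq`**, **`norm_torusFourierInv_uvSpatialSample_le_inv_pow_offSite_bare_sq`** — summable over ALL
  Matsubara frequencies, so the (L)-clause of SPEC v2 §2a applies to the full frequency series and the off-site kernel has the (M)-shape `O(ω⁻²)·(1+‖z‖)⁻ⁿ`.

Proofs only; no definitions; nothing here asserts (C), any stub of 20437, K3 or superconductivity.  References: BGM 2006 (2.36aa), §3 (3.2) [cite: BenfattoGiulianiMastropietro2006].
-/

noncomputable section

namespace Summit.HubbardSuperconductivity.HubbardSuperconductivity.Theorems.KLRegimeSplit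

set_option linter.dupNamespace false -- summit = problem name (single-conjunct summit), D-0017

open Literature.MathematicalPhysics.QuantumLattice Literature.Probability.LatticeModels Literature.Analysis.FunctionSpaces
open Summit.HubbardSuperconductivity.HubbardSuperconductivity.Theorems.DispersionFlow
open Summit.HubbardSuperconductivity.HubbardSuperconductivity.Theorems.EngineV8 (contDiff_frameLevel norm_iteratedFDeriv_frameLevel_zero_le)
open Finset Complex UnitAddTorus Real
open scoped ContDiff Nat

variable {L : ℕ} [NeZero L]

/-! ## §1 Rescaling -/

/-- **Rescaling costs `|a|ⁿ`**: `‖Dⁿ(y ↦ f(a•y))(y)‖ ≤ |a|ⁿ·‖Dⁿ f (a•y)‖` for `f` of class `Cⁿ` on a real normed space. -/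
theorem norm_iteratedFDeriv_comp_smul_le {V F : Type*} [NormedAddCommGroup V] [NormedSpace ℝ V] [NormedAddCommGroup F] [NormedSpace ℝ F]
    {f : V → F} {n : ℕ} (hf : ContDiff ℝ n f) (a : ℝ) (y : V) :
    ‖iteratedFDeriv ℝ n (fun y : V => f (a • y)) y‖ ≤ |a| ^ n * ‖iteratedFDeriv ℝ n f (a • y)‖ := by
  have hcomp : (fun y : V => f (a • y)) = f ∘ (a • ContinuousLinearMap.id ℝ V) := by
    funext y; simp
  rw [hcomp, ContinuousLinearMap.iteratedFDeriv_comp_right (a • ContinuousLinearMap.id ℝ V) hf y le_rfl]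
  refine (ContinuousMultilinearMap.norm_compContinuousLinearMap_le _ _).trans ?_
  rw [Finset.prod_const, Finset.card_univ, Fintype.card_fin, mul_comm]
  have h1 : ‖a • ContinuousLinearMap.id ℝ V‖ ≤ |a| := by
    rw [norm_smul, Real.norm_eq_abs]
    exact mul_le_of_le_one_right (abs_nonneg a) ContinuousLinearMap.norm_id_le
  have h2 : (a • ContinuousLinearMap.id ℝ V) y = a • y := by simp
  rw [h2]
  exact mul_le_mul_of_nonneg_right (pow_le_pow_left₀ (norm_nonneg _) h1 n) (norm_nonneg _)

/-! ## §2 The spatial symbol as (joint symbol) ∘ (frequency, band) -/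

/-- `g_ω = uvSymbol₂ c Λ ∘ fbPt ω ∘ e_K ∘ (2π•)`. -/
theorem uvSpatialSymbol_eq_uvSymbol₂_comp (c Λ μ : ℝ) (K : TrigPolyC4v) (om : ℝ) :
    (fun y : Momentum => uvSymbolFn c Λ (frameLevel μ K ((2 * π) • y)) om) =
      fun y : Momentum => (fun q : Momentum => uvSymbol₂ c Λ (fbPt om (frameLevel μ K q))) ((2 * π) • y) := by
  funext y
  simp only [uvSymbol₂_apply_eq_uvSymbolFn, fbPt_apply_zero, fbPt_apply_one]

/-! ## §3 The momentum-jet number from the symbol table and the band jets -/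

/-- **Momentum jets of the spatial symbol**: if `|χ₂^{(i)}| ≤ B` (`i ≤ n`, `1 ≤ B`), `0 ≤ c`, `0 < Λ`, and the band has `‖Dⁱ e_K(q)‖ ≤ D_Kⁱ` for
`1 ≤ i ≤ n`, then at every `y`:
`‖Dⁿ g_ω(y)‖ ≤ n!·(c·B·(n+1)!·(2/m)·max(1,2/m)ⁿ)·(2π·D_K)ⁿ`, `m = max(|ω|, Λ/2)`. -/
theorem norm_iteratedFDeriv_uvSpatialSymbol_le {c Λ : ℝ} (hc : 0 ≤ c) (hΛ : 0 < Λ) (μ : ℝ) (K : TrigPolyC4v) (om : ℝ) {n : ℕ} {B : ℝ}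
    (hB1 : 1 ≤ B) (hB : ∀ i ≤ n, ∀ t, ‖iteratedDeriv i salmhoferCutoff t‖ ≤ B) {DK : ℝ}
    (hK : ∀ i : ℕ, 1 ≤ i → i ≤ n → ∀ q : Momentum, ‖iteratedFDeriv ℝ i (frameLevel μ K) q‖ ≤ DK ^ i) (y : Momentum) :
    ‖iteratedFDeriv ℝ n (fun y : Momentum => uvSymbolFn c Λ (frameLevel μ K ((2 * π) • y)) om) y‖ ≤
      n ! * (c * B * (n + 1) ! * (2 / max |om| (Λ / 2)) * (max 1 (2 / max |om| (Λ / 2))) ^ n) * ((2 * π) * DK) ^ n := by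
  set m : ℝ := max |om| (Λ / 2) with hm
  have hm0 : 0 < m := lt_max_of_lt_right (by positivity)
  set C : ℝ := c * B * (n + 1) ! * (2 / m) * (max 1 (2 / m)) ^ n with hCdef
  have hB0 : 0 ≤ B := zero_le_one.trans hB1
  -- the joint jets at every point `(om, e)` up to order `n` are bounded by `C`
  have hC : ∀ (p : Momentum) (i : ℕ), i ≤ n → ‖iteratedFDeriv ℝ i (uvSymbol₂ c Λ) (fbPt om (frameLevel μ K p))‖ ≤ C := by
    intro p i hi
    have h := norm_iteratedFDeriv_uvSymbol₂_le hc hΛ hB1 hB hi (fbPt om (frameLevel μ K p))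
    rw [fbPt_apply_zero] at h
    refine h.trans ?_
    rw [hCdef]
    have hfac : ((i + 1) ! : ℝ) ≤ (n + 1) ! := by exact_mod_cast Nat.factorial_le (by omega)
    have hpow : (2 / m) ^ (i + 1) ≤ (2 / m) * (max 1 (2 / m)) ^ n := by
      rw [pow_succ', ]
      refine mul_le_mul_of_nonneg_left ?_ (by positivity)
      calc (2 / m) ^ i ≤ (max 1 (2 / m)) ^ i := pow_le_pow_left₀ (by positivity) (le_max_right _ _) i
        _ ≤ (max 1 (2 / m)) ^ n := pow_le_pow_right₀ (le_max_left _ _) hi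
    calc c * B * ((i + 1) ! : ℝ) * (2 / m) ^ (i + 1) ≤ c * B * ((n + 1) ! : ℝ) * ((2 / m) * (max 1 (2 / m)) ^ n) := by
          gcongr
      _ = c * B * (n + 1) ! * (2 / m) * (max 1 (2 / m)) ^ n := by ring
  -- composition with the band, then rescaling by `2π`
  have hband : ∀ p : Momentum, ‖iteratedFDeriv ℝ n (fun q : Momentum => uvSymbol₂ c Λ (fbPt om (frameLevel μ K q))) p‖ ≤ n ! * C * DK ^ n :=
    fun p => norm_iteratedFDeriv_uvSymbol₂_comp_band_le hΛ ((contDiff_frameLevel μ K).of_le le_top) om p (hC p) (fun i hi1 hin => hK i hi1 hin p)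
  have hcd : ContDiff ℝ n (fun q : Momentum => uvSymbol₂ c Λ (fbPt om (frameLevel μ K q))) :=
    (contDiff_uvSymbol₂ c hΛ).comp (contDiff_fbPt_comp ((contDiff_frameLevel μ K).of_le le_top) om)
  rw [uvSpatialSymbol_eq_uvSymbol₂_comp]
  refine (norm_iteratedFDeriv_comp_smul_le hcd (2 * π) y).trans ?_
  calc |2 * π| ^ n * ‖iteratedFDeriv ℝ n (fun q : Momentum => uvSymbol₂ c Λ (fbPt om (frameLevel μ K q))) ((2 * π) • y)‖
      ≤ |2 * π| ^ n * (n ! * C * DK ^ n) := mul_le_mul_of_nonneg_left (hband _) (by positivity)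
    _ = n ! * C * ((2 * π) * DK) ^ n := by rw [abs_of_pos (by positivity : (0 : ℝ) < 2 * π), mul_pow]; ring

/-! ## §4 The bare frame `K = 0`: band jets `≤ 4 ≤ 4ⁱ` -/

/-- **Bare-frame momentum jets**: with `D_K = 4`, `‖Dⁿ g_ω(y)‖ ≤ n!·(c·B·(n+1)!·(2/m)·max(1,2/m)ⁿ)·(8π)ⁿ` at `K = 0`. -/
theorem norm_iteratedFDeriv_uvSpatialSymbol_bare_le {c Λ : ℝ} (hc : 0 ≤ c) (hΛ : 0 < Λ) (μ : ℝ) (om : ℝ) {n : ℕ} {B : ℝ}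
    (hB1 : 1 ≤ B) (hB : ∀ i ≤ n, ∀ t, ‖iteratedDeriv i salmhoferCutoff t‖ ≤ B) (y : Momentum) :
    ‖iteratedFDeriv ℝ n (fun y : Momentum => uvSymbolFn c Λ (frameLevel μ 0 ((2 * π) • y)) om) y‖ ≤
      n ! * (c * B * (n + 1) ! * (2 / max |om| (Λ / 2)) * (max 1 (2 / max |om| (Λ / 2))) ^ n) * ((2 * π) * 4) ^ n := by
  refine norm_iteratedFDeriv_uvSpatialSymbol_le hc hΛ μ 0 om hB1 hB (fun i hi1 _ q => ?_) y
  calc ‖iteratedFDeriv ℝ i (frameLevel μ 0) q‖ ≤ 4 := norm_iteratedFDeriv_frameLevel_zero_le μ hi1 q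
    _ = 4 ^ 1 := (pow_one _).symm
    _ ≤ 4 ^ i := pow_le_pow_right₀ (by norm_num) hi1

/-! ## §5 The §2a (L) clauses at the bare frame with explicit numbers -/

/-- **Torus comparison of the scale-`0` covariance at the bare frame, per frequency, explicit**: for `0 ≤ c`, `0 < Λ`, `ω ≠ 0`, `n ≥ 4`, the cutoff
table `|χ₂^{(i)}| ≤ B` (`i ≤ n`, `B ≥ 1`), every box radius `R` and EVERY `L ≥ R + 1 + Σ_j|z_j|`:
`‖L⁻²Σ_{k⃗} χ_{k⃗}(z̄)Ψ(ω, ξ(k⃗)) − a_ω(z)‖ ≤ [n!·(c·B·(n+1)!·(2/m)·max(1,2/m)ⁿ)·(8π)ⁿ]/(2π)ⁿ·(2/(2R+2))^{n−4}·4C₂`. -/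
theorem norm_torusFourierInv_uvSpatialSample_sub_kernel_le_bare {c Λ : ℝ} (hc : 0 ≤ c) (hΛ : 0 < Λ) (μ : ℝ) {om : ℝ} (hom : om ≠ 0)
    {n : ℕ} (hn : 2 * 2 ≤ n) {B : ℝ} (hB1 : 1 ≤ B) (hB : ∀ i ≤ n, ∀ t, ‖iteratedDeriv i salmhoferCutoff t‖ ≤ B)
    {R : ℕ} (z : Site 2) (hR : (R : ℤ) + 1 + ∑ i, |z i| ≤ L) :
    ‖torusFourierInv (fun kv : TorusSite 2 L =>
          (fun y : Momentum => uvSymbolFn c Λ (frameLevel μ 0 ((2 * π) • y)) om) (WithLp.toLp 2 fun i => ((kv i).val : ℝ) / L))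
          (Torus.proj L z) -
        mFourierCoeff (Torus.descend (fun y : Momentum => uvSymbolFn c Λ (frameLevel μ 0 ((2 * π) • y)) om)
          (uvSpatialSymbol_isLatticePeriodic c Λ μ 0 om)) (-z)‖ ≤
      (n ! * (c * B * (n + 1) ! * (2 / max |om| (Λ / 2)) * (max 1 (2 / max |om| (Λ / 2))) ^ n) * ((2 * π) * 4) ^ n) /
          (2 * Real.pi) ^ n * (2 / ((2 * R + 2 : ℕ) : ℝ)) ^ (n - 2 * 2) * (2 ^ 2 * ∑' k : Site 2, ∏ j, (1 + (k j : ℝ) ^ 2)⁻¹) :=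
  norm_torusFourierInv_uvSpatialSample_sub_kernel_le c μ 0 hom hn (norm_iteratedFDeriv_uvSpatialSymbol_bare_le hc hΛ μ om hB1 hB) z hR

/-- **Off-site L-uniform decay of the scale-`0` covariance's spatial factor at the bare frame, per frequency, explicit**: for centred off-site `z`
(`2‖z‖_∞ ≤ L`, `z̄ ≠ 0`) and every `L ≥ 1`:
`‖L⁻²Σ_{k⃗} χ_{k⃗}(z̄)Ψ(ω, ξ(k⃗))‖ ≤ [n!·(c·B·(n+1)!·(2/m)·max(1,2/m)ⁿ)·(8π)ⁿ/πⁿ]·(1 + 4ⁿS_n)·(1+‖z‖_∞)^{−n}` — of size `O(1/m(ω))·…`; the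
`1/ω²` shape needs `n ≥ 1` band derivatives inside the joint jets, which the crude composition constant does not separate (see file docstring). -/
theorem norm_torusFourierInv_uvSpatialSample_le_inv_pow_offSite_bare {c Λ : ℝ} (hc : 0 ≤ c) (hΛ : 0 < Λ) (μ : ℝ) {om : ℝ} (hom : om ≠ 0)
    {n : ℕ} (hn : 2 * 2 ≤ n) {B : ℝ} (hB1 : 1 ≤ B) (hB : ∀ i ≤ n, ∀ t, ‖iteratedDeriv i salmhoferCutoff t‖ ≤ B)
    {z : Site 2} (hz : 2 * ‖z‖ ≤ L) (hz0 : Torus.proj L z ≠ 0) :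
    ‖torusFourierInv (fun kv : TorusSite 2 L =>
          (fun y : Momentum => uvSymbolFn c Λ (frameLevel μ 0 ((2 * π) • y)) om) (WithLp.toLp 2 fun i => ((kv i).val : ℝ) / L))
          (Torus.proj L z)‖ ≤
      ((n ! * (c * B * (n + 1) ! * (2 / max |om| (Λ / 2)) * (max 1 (2 / max |om| (Λ / 2))) ^ n) * ((2 * π) * 4) ^ n) / Real.pi ^ n) *
        (1 + (4 : ℝ) ^ n * ∑' k : Site 2, ((1 + ‖k‖) ^ n)⁻¹) * ((1 + ‖z‖) ^ n)⁻¹ :=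
  norm_torusFourierInv_uvSpatialSample_le_inv_pow_offSite c μ 0 hom hn (norm_iteratedFDeriv_uvSpatialSymbol_bare_le hc hΛ μ om hB1 hB) hz hz0

/-! ## §6 Orders `n ≥ 1` never read the value of the outer function: the `O(1/m(ω)²)` momentum jets -/

/-- **Faà di Bruno without the value term**: for `n ≥ 1`, `‖Dⁿ(g ∘ f)(x)‖ ≤ n!·C·Dⁿ` as soon as `‖Dⁱg(f x)‖ ≤ C` for `1 ≤ i ≤ n` (the order-`0` jet of `g`
is not needed) and `‖Dⁱf(x)‖ ≤ Dⁱ` for `1 ≤ i ≤ n` — Mathlib's `norm_iteratedFDeriv_comp_le` applied to `g − g(f x)`. -/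
theorem norm_iteratedFDeriv_comp_le_of_one_le {E F G : Type*} [NormedAddCommGroup E] [NormedSpace ℝ E] [NormedAddCommGroup F] [NormedSpace ℝ F]
    [NormedAddCommGroup G] [NormedSpace ℝ G] {g : F → G} {f : E → F} {n : ℕ} {N : WithTop ℕ∞} (hg : ContDiff ℝ N g) (hf : ContDiff ℝ N f)
    (hn : (n : WithTop ℕ∞) ≤ N) (hn1 : 1 ≤ n) (x : E) {C D : ℝ} (hC : ∀ i, 1 ≤ i → i ≤ n → ‖iteratedFDeriv ℝ i g (f x)‖ ≤ C)
    (hD : ∀ i, 1 ≤ i → i ≤ n → ‖iteratedFDeriv ℝ i f x‖ ≤ D ^ i) :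
    ‖iteratedFDeriv ℝ n (g ∘ f) x‖ ≤ n ! * C * D ^ n := by
  set g' : F → G := g - fun _ => g (f x) with hg'
  have hg'c : ContDiff ℝ N g' := hg.sub contDiff_const
  have hC0 : 0 ≤ C := (norm_nonneg _).trans (hC 1 le_rfl hn1)
  have hgn : ContDiff ℝ n g := hg.of_le hn
  -- the jets of `g'` at `f x`: order `0` vanishes, orders `≥ 1` are those of `g`
  have hC' : ∀ i, i ≤ n → ‖iteratedFDeriv ℝ i g' (f x)‖ ≤ C := by
    intro i hi
    rcases Nat.eq_zero_or_pos i with rfl | hi1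
    · rw [iteratedFDeriv_zero_eq_comp, Function.comp_apply, LinearIsometryEquiv.norm_map]
      simp only [hg', Pi.sub_apply, sub_self, norm_zero]
      exact hC0
    · have hgi : ContDiff ℝ i g := hgn.of_le (by exact_mod_cast hi)
      rw [hg', iteratedFDeriv_sub_apply hgi.contDiffAt contDiff_const.contDiffAt, iteratedFDeriv_const_of_ne (by omega),
        Pi.zero_apply, sub_zero]
      exact hC i hi1 hi
  have key := norm_iteratedFDeriv_comp_le (g := g') (f := f) (N := N) hg'c hf hn x hC' hD
  -- `g' ∘ f = g ∘ f − const`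
  have hcomp : g' ∘ f = (g ∘ f) - fun _ => g (f x) := by funext y; simp [hg']
  have hgf : ContDiff ℝ n (g ∘ f) := hgn.comp (hf.of_le hn)
  rw [hcomp, iteratedFDeriv_sub_apply hgf.contDiffAt contDiff_const.contDiffAt, iteratedFDeriv_const_of_ne (by omega),
    Pi.zero_apply, sub_zero] at key
  exact key

/-- **`‖Dⁿ(Ψ(ω, u ·))(p)‖ ≤ n!·C′·Dⁿ` for `n ≥ 1`** when `‖DⁱΨ(ω, u p)‖ ≤ C′` for `1 ≤ i ≤ n` ONLY and `‖Dⁱu(p)‖ ≤ Dⁱ` for `1 ≤ i ≤ n` — the order-`0`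
joint jet (the `1/m(ω)`-sized VALUE of the symbol) never enters a derivative of order `≥ 1` (companion of
`HubbardUVSymbolBandComposition.norm_iteratedFDeriv_uvSymbol₂_comp_band_le`). -/
theorem norm_iteratedFDeriv_uvSymbol₂_comp_band_le_of_one_le {V : Type*} [NormedAddCommGroup V] [NormedSpace ℝ V] {c Λ : ℝ} (hΛ : 0 < Λ)
    {n : ℕ} (hn1 : 1 ≤ n) {u : V → ℝ} (hu : ContDiff ℝ n u) (om : ℝ) (p : V) {C D : ℝ}
    (hC : ∀ i, 1 ≤ i → i ≤ n → ‖iteratedFDeriv ℝ i (uvSymbol₂ c Λ) (fbPt om (u p))‖ ≤ C)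
    (hD : ∀ i, 1 ≤ i → i ≤ n → ‖iteratedFDeriv ℝ i u p‖ ≤ D ^ i) :
    ‖iteratedFDeriv ℝ n (fun p => uvSymbol₂ c Λ (fbPt om (u p))) p‖ ≤ n ! * C * D ^ n :=
  norm_iteratedFDeriv_comp_le_of_one_le (g := uvSymbol₂ c Λ) (f := fun p => fbPt om (u p)) (N := (n : WithTop ℕ∞))
    (contDiff_uvSymbol₂ c hΛ) (contDiff_fbPt_comp hu om) le_rfl hn1 p hC (fun i hi1 hin => by
      rw [norm_iteratedFDeriv_fbPt_comp hi1 (hu.of_le (by exact_mod_cast hin)) om p]; exact hD i hi1 hin)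

/-- **Momentum jets of the spatial symbol of size `O(1/m(ω)²)`**: if `|χ₂^{(i)}| ≤ B` (`i ≤ n`, `1 ≤ B`), `0 ≤ c`, `0 < Λ`, and the band has
`‖Dⁱ e_K(q)‖ ≤ D_Kⁱ` for `1 ≤ i ≤ n`, then for `n ≥ 1` at every `y`:
`‖Dⁿ g_ω(y)‖ ≤ n!·(c·B·(n+1)!·(2/m)²·max(1,2/m)^{n−1})·(2π·D_K)ⁿ`, `m = max(|ω|, Λ/2)` — one power of `1/m` better than
`norm_iteratedFDeriv_uvSpatialSymbol_le`, and summable over the Matsubara frequencies. -/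
theorem norm_iteratedFDeriv_uvSpatialSymbol_le_of_one_le {c Λ : ℝ} (hc : 0 ≤ c) (hΛ : 0 < Λ) (μ : ℝ) (K : TrigPolyC4v) (om : ℝ) {n : ℕ}
    (hn1 : 1 ≤ n) {B : ℝ} (hB1 : 1 ≤ B) (hB : ∀ i ≤ n, ∀ t, ‖iteratedDeriv i salmhoferCutoff t‖ ≤ B) {DK : ℝ}
    (hK : ∀ i : ℕ, 1 ≤ i → i ≤ n → ∀ q : Momentum, ‖iteratedFDeriv ℝ i (frameLevel μ K) q‖ ≤ DK ^ i) (y : Momentum) :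
    ‖iteratedFDeriv ℝ n (fun y : Momentum => uvSymbolFn c Λ (frameLevel μ K ((2 * π) • y)) om) y‖ ≤
      n ! * (c * B * (n + 1) ! * (2 / max |om| (Λ / 2)) ^ 2 * (max 1 (2 / max |om| (Λ / 2))) ^ (n - 1)) * ((2 * π) * DK) ^ n := by
  set m : ℝ := max |om| (Λ / 2) with hm
  have hm0 : 0 < m := lt_max_of_lt_right (by positivity)
  set C : ℝ := c * B * (n + 1) ! * (2 / m) ^ 2 * (max 1 (2 / m)) ^ (n - 1) with hCdef
  have hB0 : 0 ≤ B := zero_le_one.trans hB1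
  -- the joint jets of orders `1 ≤ i ≤ n` at every point `(om, e)` are bounded by `C`
  have hC : ∀ (p : Momentum) (i : ℕ), 1 ≤ i → i ≤ n → ‖iteratedFDeriv ℝ i (uvSymbol₂ c Λ) (fbPt om (frameLevel μ K p))‖ ≤ C := by
    intro p i hi1 hi
    have h := norm_iteratedFDeriv_uvSymbol₂_le hc hΛ hB1 hB hi (fbPt om (frameLevel μ K p))
    rw [fbPt_apply_zero] at h
    refine h.trans ?_
    rw [hCdef]
    have hfac : ((i + 1) ! : ℝ) ≤ (n + 1) ! := by exact_mod_cast Nat.factorial_le (by omega)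
    have hpow : (2 / m) ^ (i + 1) ≤ (2 / m) ^ 2 * (max 1 (2 / m)) ^ (n - 1) := by
      obtain ⟨j, rfl⟩ : ∃ j, i = j + 1 := ⟨i - 1, by omega⟩
      rw [show j + 1 + 1 = 2 + j by ring, pow_add]
      refine mul_le_mul_of_nonneg_left ?_ (by positivity)
      calc (2 / m) ^ j ≤ (max 1 (2 / m)) ^ j := pow_le_pow_left₀ (by positivity) (le_max_right _ _) j
        _ ≤ (max 1 (2 / m)) ^ (n - 1) := pow_le_pow_right₀ (le_max_left _ _) (by omega)
    calc c * B * ((i + 1) ! : ℝ) * (2 / m) ^ (i + 1) ≤ c * B * ((n + 1) ! : ℝ) * ((2 / m) ^ 2 * (max 1 (2 / m)) ^ (n - 1)) := by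
          gcongr
      _ = c * B * (n + 1) ! * (2 / m) ^ 2 * (max 1 (2 / m)) ^ (n - 1) := by ring
  have hband : ∀ p : Momentum, ‖iteratedFDeriv ℝ n (fun q : Momentum => uvSymbol₂ c Λ (fbPt om (frameLevel μ K q))) p‖ ≤ n ! * C * DK ^ n :=
    fun p => norm_iteratedFDeriv_uvSymbol₂_comp_band_le_of_one_le hΛ hn1 ((contDiff_frameLevel μ K).of_le le_top) om p (hC p)
      (fun i hi1 hin => hK i hi1 hin p)
  have hcd : ContDiff ℝ n (fun q : Momentum => uvSymbol₂ c Λ (fbPt om (frameLevel μ K q))) :=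
    (contDiff_uvSymbol₂ c hΛ).comp (contDiff_fbPt_comp ((contDiff_frameLevel μ K).of_le le_top) om)
  rw [uvSpatialSymbol_eq_uvSymbol₂_comp]
  refine (norm_iteratedFDeriv_comp_smul_le hcd (2 * π) y).trans ?_
  calc |2 * π| ^ n * ‖iteratedFDeriv ℝ n (fun q : Momentum => uvSymbol₂ c Λ (fbPt om (frameLevel μ K q))) ((2 * π) • y)‖
      ≤ |2 * π| ^ n * (n ! * C * DK ^ n) := mul_le_mul_of_nonneg_left (hband _) (by positivity)
    _ = n ! * C * ((2 * π) * DK) ^ n := by rw [abs_of_pos (by positivity : (0 : ℝ) < 2 * π), mul_pow]; ring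

/-- **Bare-frame momentum jets of size `O(1/m(ω)²)`**: with `D_K = 4`, for `n ≥ 1`,
`‖Dⁿ g_ω(y)‖ ≤ n!·(c·B·(n+1)!·(2/m)²·max(1,2/m)^{n−1})·(8π)ⁿ` at `K = 0`. -/
theorem norm_iteratedFDeriv_uvSpatialSymbol_bare_le_of_one_le {c Λ : ℝ} (hc : 0 ≤ c) (hΛ : 0 < Λ) (μ : ℝ) (om : ℝ) {n : ℕ} (hn1 : 1 ≤ n)
    {B : ℝ} (hB1 : 1 ≤ B) (hB : ∀ i ≤ n, ∀ t, ‖iteratedDeriv i salmhoferCutoff t‖ ≤ B) (y : Momentum) :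
    ‖iteratedFDeriv ℝ n (fun y : Momentum => uvSymbolFn c Λ (frameLevel μ 0 ((2 * π) • y)) om) y‖ ≤
      n ! * (c * B * (n + 1) ! * (2 / max |om| (Λ / 2)) ^ 2 * (max 1 (2 / max |om| (Λ / 2))) ^ (n - 1)) * ((2 * π) * 4) ^ n := by
  refine norm_iteratedFDeriv_uvSpatialSymbol_le_of_one_le hc hΛ μ 0 om hn1 hB1 hB (fun i hi1 _ q => ?_) y
  calc ‖iteratedFDeriv ℝ i (frameLevel μ 0) q‖ ≤ 4 := norm_iteratedFDeriv_frameLevel_zero_le μ hi1 q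
    _ = 4 ^ 1 := (pow_one _).symm
    _ ≤ 4 ^ i := pow_le_pow_right₀ (by norm_num) hi1

/-- **Torus comparison at the bare frame with the `O(1/m(ω)²)` constant** (`n ≥ 4`, so `n ≥ 1` automatically): for `0 ≤ c`, `0 < Λ`, `ω ≠ 0`, the
cutoff table `|χ₂^{(i)}| ≤ B` (`i ≤ n`, `B ≥ 1`), every box radius `R` and every `L ≥ R + 1 + Σ_j|z_j|`:
`‖L⁻²Σ_{k⃗} χ_{k⃗}(z̄)Ψ(ω, ξ(k⃗)) − a_ω(z)‖ ≤ [n!·(c·B·(n+1)!·(2/m)²·max(1,2/m)^{n−1})·(8π)ⁿ]/(2π)ⁿ·(2/(2R+2))^{n−4}·4C₂` — summable over the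
Matsubara frequencies, so the (L)-clause of SPEC v2 §2a applies to the FULL frequency series, not only to the window. -/
theorem norm_torusFourierInv_uvSpatialSample_sub_kernel_le_bare_sq {c Λ : ℝ} (hc : 0 ≤ c) (hΛ : 0 < Λ) (μ : ℝ) {om : ℝ} (hom : om ≠ 0)
    {n : ℕ} (hn : 2 * 2 ≤ n) {B : ℝ} (hB1 : 1 ≤ B) (hB : ∀ i ≤ n, ∀ t, ‖iteratedDeriv i salmhoferCutoff t‖ ≤ B)
    {R : ℕ} (z : Site 2) (hR : (R : ℤ) + 1 + ∑ i, |z i| ≤ L) :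
    ‖torusFourierInv (fun kv : TorusSite 2 L =>
          (fun y : Momentum => uvSymbolFn c Λ (frameLevel μ 0 ((2 * π) • y)) om) (WithLp.toLp 2 fun i => ((kv i).val : ℝ) / L))
          (Torus.proj L z) -
        mFourierCoeff (Torus.descend (fun y : Momentum => uvSymbolFn c Λ (frameLevel μ 0 ((2 * π) • y)) om)
          (uvSpatialSymbol_isLatticePeriodic c Λ μ 0 om)) (-z)‖ ≤
      (n ! * (c * B * (n + 1) ! * (2 / max |om| (Λ / 2)) ^ 2 * (max 1 (2 / max |om| (Λ / 2))) ^ (n - 1)) * ((2 * π) * 4) ^ n) /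
          (2 * Real.pi) ^ n * (2 / ((2 * R + 2 : ℕ) : ℝ)) ^ (n - 2 * 2) * (2 ^ 2 * ∑' k : Site 2, ∏ j, (1 + (k j : ℝ) ^ 2)⁻¹) :=
  norm_torusFourierInv_uvSpatialSample_sub_kernel_le c μ 0 hom hn
    (norm_iteratedFDeriv_uvSpatialSymbol_bare_le_of_one_le hc hΛ μ om (by omega) hB1 hB) z hR

/-- **Off-site `L`-uniform decay at the bare frame with the `O(1/m(ω)²)` constant**: for centred off-site `z` (`2‖z‖_∞ ≤ L`, `z̄ ≠ 0`), `n ≥ 4`: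
`‖L⁻²Σ_{k⃗} χ_{k⃗}(z̄)Ψ(ω, ξ(k⃗))‖ ≤ [n!·(c·B·(n+1)!·(2/m)²·max(1,2/m)^{n−1})·(8π)ⁿ/πⁿ]·(1 + 4ⁿS_n)·(1+‖z‖_∞)^{−n}` — BOTH decaying in the site
and summable over the frequencies: the shape SPEC v2 §2a (M) asks of the off-site kernel. -/
theorem norm_torusFourierInv_uvSpatialSample_le_inv_pow_offSite_bare_sq {c Λ : ℝ} (hc : 0 ≤ c) (hΛ : 0 < Λ) (μ : ℝ) {om : ℝ} (hom : om ≠ 0)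
    {n : ℕ} (hn : 2 * 2 ≤ n) {B : ℝ} (hB1 : 1 ≤ B) (hB : ∀ i ≤ n, ∀ t, ‖iteratedDeriv i salmhoferCutoff t‖ ≤ B)
    {z : Site 2} (hz : 2 * ‖z‖ ≤ L) (hz0 : Torus.proj L z ≠ 0) :
    ‖torusFourierInv (fun kv : TorusSite 2 L =>
          (fun y : Momentum => uvSymbolFn c Λ (frameLevel μ 0 ((2 * π) • y)) om) (WithLp.toLp 2 fun i => ((kv i).val : ℝ) / L))
          (Torus.proj L z)‖ ≤
      ((n ! * (c * B * (n + 1) ! * (2 / max |om| (Λ / 2)) ^ 2 * (max 1 (2 / max |om| (Λ / 2))) ^ (n - 1)) * ((2 * π) * 4) ^ n) / Real.pi ^ n) *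
        (1 + (4 : ℝ) ^ n * ∑' k : Site 2, ((1 + ‖k‖) ^ n)⁻¹) * ((1 + ‖z‖) ^ n)⁻¹ :=
  norm_torusFourierInv_uvSpatialSample_le_inv_pow_offSite c μ 0 hom hn
    (norm_iteratedFDeriv_uvSpatialSymbol_bare_le_of_one_le hc hΛ μ om (by omega) hB1 hB) hz hz0

end Summit.HubbardSuperconductivity.HubbardSuperconductivity.Theorems.KLRegimeSplit

end
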